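import Summits.AtomisticToContinuum.BoseEinsteinCondensation.Theorems.BECInsertionCorrectorStaticResponseBoundFsumCalibration
import Summits.AtomisticToContinuum.BoseEinsteinCondensation.Theorems.BECInsertionCorrectorStaticResponseBoundInfraredToTorusHyperuniformity
import Summits.AtomisticToContinuum.BoseEinsteinCondensation.Theorems.BECConjugateDominationPositiveMinimiserFinal
import Summits.AtomisticToContinuum.BoseEinsteinCondensation.Theorems.BECConjugateDominationNearMinimiserStabilityHelpers
import Literature.MathematicalPhysics.QuantumManyBody.PeriodicGroundStateNondegenerateProofs
import Literature.MathematicalPhysics.QuantumManyBody.PeriodicClusteringFromKyFanGap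
import Literature.MathematicalPhysics.QuantumManyBody.PeriodicConfigLaplacian
import Literature.MathematicalPhysics.QuantumManyBody.PeriodicBoseGasImpurityTranslation
import HarnessLib

/-!
# Crux `CorrectorClosure` (stmt-AtomisticToContinuum-12058), line `volume-homotopy-sum-rule-domination` —
# registered stub `stub_longWaveStructureOfSRB`, auxiliary file 1/3: every torus minimiser inherits the
# Onsager–Price structure bound that K1 forces on the positive one

Supports (does not close) stmt-AtomisticToContinuum-12058, route `BECInsertionCorrector`.

The kill-edge `hyperuniformity_of_staticResponseBound` (file `…StaticResponseBoundFsumCalibration`) turns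
the crux hypothesis `StaticResponseBound` (K1) into the bound
`(∫ (∑ⱼ cos p·xⱼ)² |Θ|²)² ≤ 4 (C N / max(ρa, |p|²)) · N|p|²/8 ≤ C N²/2` for every REAL, non-negative,
TRANSLATION-INVARIANT exact minimiser `Θ` of the periodic `N`-body energy in the thermodynamic box
`sideLength ρ N`, `ρ < ρ₀(v)`, every `N ≥ 1` and every mode `p = 2πk/L`, `k ≠ 0`.  This file removes the
three adjectives for the smooth class of potentials (finite, `C²`-radial, edge condition):

* `norm_eq_norm_of_minimisers` — **rigidity of the modulus**: two exact minimisers `Ψ, Θ` at the same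
  `(N, L)` have `|Ψ(X)| = |Θ(X)|` for every `X` (the bosonic torus ground state is nondegenerate,
  `PeriodicGroundStateNondegenerate_holds`; the Ky Fan gap clusters minimisers modulo a phase,
  `exists_phase_integral_norm_sub_sq_le_of_kyFanGap`, so `∫_{cell^N} (|Ψ| − |Θ|)² ≤ η` for every `η > 0`;
  a continuous periodic function with vanishing `L²` norm on the cell vanishes,
  `IsTorusPeriodic.eq_zero_of_lintegral_normSq_eq_zero`);
* `hasTotalMomentum_zero_of_real_minimiser` — a real non-negative minimiser is invariant under simultaneous
  translation of all particles (its translate is a minimiser with the same modulus);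
* `sq_moment_le_of_staticResponseBound` — **K1 ⇒ `‖ρ_k†Ψ‖² ≤ 2√(C/2)·N`** for EVERY exact minimiser
  `Ψ` at every `(N, L)` with `N ≥ 1`, `N/L³ < ρ₀(v)` and every `k ≠ 0`: put `ρ := N/L³`, so that
  `sideLength ρ N = L` (`ecsf9093_sideLength_eq`) and K1's block speaks about the box `L`; run the
  kill-edge on the positive minimiser `Θ` of `PositiveMinimiser_proof` (translation invariant by the
  previous item); the SIN² moment of `Θ` is the COS² moment of a quarter-wave translate
  (`thp_exists_translate_sin_sq`), again a minimiser, whose modulus is `|Θ|` by rigidity; finally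
  `|ρ̂_k|² = (∑cos)² + (∑sin)²` and `|Ψ| = |Θ|`.

## References

* [ReedSimonIV1978] M. Reed, B. Simon, *Methods of Modern Mathematical Physics IV*, §XIII.12,
  Thms XIII.43–XIII.47 (nondegenerate positive ground state of the torus Bose gas).
* [Stringari1995] S. Stringari, *Sum rules and Bose–Einstein condensation*, §3 (40) (the
  compressibility bound on the static structure factor).
-/

noncomputable section

open MeasureTheory Filter
open scoped ENNReal NNReal BigOperators ComplexConjugate

namespace Summit.AtomisticToContinuum.BoseEinsteinCondensation.Theorems.CorrectorClosure.VolumeHomotopySumRuleDomination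

open Literature.MathematicalPhysics.QuantumManyBody
open Literature.MathematicalPhysics.QuantumManyBody.BoseGas
open Summit.AtomisticToContinuum.BoseEinsteinCondensation.Theses.BECInsertionCorrector
open Summit.AtomisticToContinuum.BoseEinsteinCondensation.Theorems.StaticResponseBound.Negative
  (psq psq_nonneg)
open Summit.AtomisticToContinuum.BoseEinsteinCondensation.Cruxes.StaticResponseBound.StableFractionSquareCompletion
  (hyperuniformity_of_staticResponseBound ecsf9093_sideLength_eq ecsf9093_lintegral_densityWave_sq_eq
    ecsf9093_two_pi_div_le_sqrt_psq)
open Summit.AtomisticToContinuum.BoseEinsteinCondensation.Cruxes.StaticResponseBound.UvThomsonForceWave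
  (thp_exists_translate_sin_sq thp_norm_densityWave_sq)

variable {N : ℕ} {L : ℝ}

/-! ### Rigidity of the modulus of a minimiser -/

/-- **Rigidity of the modulus.** For a smooth-class potential, `N ≥ 1`, `L > 0`: two exact minimisers
`Ψ, Θ` of the periodic energy (finite ground-state energy) satisfy `|Ψ(X)| = |Θ(X)|` for every `X` —
nondegeneracy of the torus ground state in Ky Fan form, clustering modulo a phase for every tolerance,
the reverse triangle inequality, and continuity + periodicity. [folklore] -/
theorem norm_eq_norm_of_minimisers {v : ℝ → ℝ≥0∞} (hv : IsRepulsiveFiniteRange v)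
    (hfin : ∀ r, v r ≠ ⊤) (hC2 : ContDiff ℝ 2 (fun x : Space => (v ‖x‖).toReal)) (hN : 1 ≤ N)
    (hL : 0 < L) (Ψ Θ : PeriodicTrialState N L)
    (hΨ : periodicEnergy v Ψ = periodicGroundStateEnergy v N L)
    (hΘ : periodicEnergy v Θ = periodicGroundStateEnergy v N L) (hΘfin : periodicEnergy v Θ ≠ ⊤)
    (X : Config N) : ‖Ψ.ψ X‖ = ‖Θ.ψ X‖ := by
  obtain ⟨hmeas, R₀, hR₀⟩ := hv
  obtain ⟨M, hM⟩ := exists_bound_of_continuous_finiteRange hfin hC2.continuous hR₀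
  obtain ⟨C, hC⟩ := exists_bound_periodizedPotential_of_space hL hM hR₀
  have hND := PeriodicGroundStateNondegenerate_holds N L v hN hL hmeas ⟨C, hC⟩
  have hE : periodicGroundStateEnergy v N L ≠ ⊤ := hΘ ▸ hΘfin
  obtain ⟨γ, hγ, hgap⟩ : ∃ γ : ℝ, 0 < γ ∧
      2 * periodicGroundStateEnergy v N L + ENNReal.ofReal γ ≤ kyFanTwo v N L := by
    obtain ⟨r, hr, hlt⟩ := ENNReal.lt_iff_exists_add_pos_lt.1 hND
    exact ⟨r, NNReal.coe_pos.2 hr, by rw [ENNReal.ofReal_coe_nnreal]; exact hlt.le⟩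
  -- the difference of the moduli, as a complex-valued continuous periodic function on `(ℝ³)^N`
  set r : Config N → ℂ := fun Y => ((‖Ψ.ψ Y‖ - ‖Θ.ψ Y‖ : ℝ) : ℂ) with hr
  have hΨc := Ψ.contDiff.continuous
  have hΘc := Θ.contDiff.continuous
  have hrc : Continuous r := by rw [hr]; fun_prop
  have hper : IsTorusPeriodic L r := fun Y i k => by
    simp only [hr, Ψ.periodic, Θ.periodic]
  have h0 : ∫⁻ Y in cellN N L, ((‖r Y‖₊ : ℝ≥0∞)) ^ 2 = 0 := by
    refine le_antisymm (ENNReal.le_of_forall_pos_le_add fun η hη _ => ?_) bot_le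
    rw [zero_add]
    obtain ⟨δ, -, hclus⟩ := exists_phase_integral_norm_sub_sq_le_of_kyFanGap hmeas hγ hE hgap
      (η := (η : ℝ)) (NNReal.coe_pos.2 hη)
    obtain ⟨θ, hθ⟩ := hclus Ψ Θ (hΨ ▸ le_self_add) (hΘ ▸ le_self_add)
    -- pointwise reverse triangle inequality `(|Ψ| - |Θ|)² ≤ |Ψ - e^{iθ}Θ|²`
    have hpt : ∀ Y, ((‖r Y‖₊ : ℝ≥0∞)) ^ 2 ≤
        ENNReal.ofReal (‖Ψ.ψ Y - Complex.exp (θ * Complex.I) * Θ.ψ Y‖ ^ 2) := by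
      intro Y
      rw [coe_nnnorm_sq_eq_ofReal]
      refine ENNReal.ofReal_le_ofReal ?_
      have hc1 : ‖Complex.exp (θ * Complex.I) * Θ.ψ Y‖ = ‖Θ.ψ Y‖ := by
        rw [norm_mul, Complex.norm_exp_ofReal_mul_I, one_mul]
      have h := abs_norm_sub_norm_le (Ψ.ψ Y) (Complex.exp (θ * Complex.I) * Θ.ψ Y)
      rw [hc1] at h
      have hn : ‖r Y‖ = |‖Ψ.ψ Y‖ - ‖Θ.ψ Y‖| := by
        simp only [hr, Complex.norm_real, Real.norm_eq_abs]
      rw [hn]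
      exact pow_le_pow_left₀ (abs_nonneg _) h 2
    have hcont : Continuous fun Y => ‖Ψ.ψ Y - Complex.exp (θ * Complex.I) * Θ.ψ Y‖ ^ 2 := by
      fun_prop
    calc ∫⁻ Y in cellN N L, ((‖r Y‖₊ : ℝ≥0∞)) ^ 2
        ≤ ∫⁻ Y in cellN N L,
            ENNReal.ofReal (‖Ψ.ψ Y - Complex.exp (θ * Complex.I) * Θ.ψ Y‖ ^ 2) :=
          lintegral_mono hpt
      _ = ENNReal.ofReal
            (∫ Y in cellN N L, ‖Ψ.ψ Y - Complex.exp (θ * Complex.I) * Θ.ψ Y‖ ^ 2) :=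
          (ofReal_integral_eq_lintegral_ofReal (integrableOn_cellN hcont L)
            (Eventually.of_forall fun Y => sq_nonneg _)).symm
      _ ≤ ENNReal.ofReal η := ENNReal.ofReal_le_ofReal hθ
      _ = η := ENNReal.ofReal_coe_nnreal
  have hX := hper.eq_zero_of_lintegral_normSq_eq_zero hL hrc h0 X
  simp only [hr, Complex.ofReal_eq_zero] at hX
  linarith

/-- **A real non-negative minimiser is translation invariant**: for a smooth-class potential, `N ≥ 1`,
`L > 0`, an exact minimiser `Θ ≥ 0` of finite energy has total momentum `0`, i.e.
`Θ(x₁ + s, …, x_N + s) = Θ(x₁, …, x_N)` (its translate is again a minimiser, hence has the same modulus).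
[folklore] -/
theorem hasTotalMomentum_zero_of_real_minimiser {v : ℝ → ℝ≥0∞} (hv : IsRepulsiveFiniteRange v)
    (hfin : ∀ r, v r ≠ ⊤) (hC2 : ContDiff ℝ 2 (fun x : Space => (v ‖x‖).toReal)) (hN : 1 ≤ N)
    (hL : 0 < L) (Θ : PeriodicTrialState N L)
    (hΘ : periodicEnergy v Θ = periodicGroundStateEnergy v N L) (hΘfin : periodicEnergy v Θ ≠ ⊤)
    (hreal : ∀ X, Θ.ψ X = (‖Θ.ψ X‖ : ℂ)) : HasTotalMomentum 0 Θ.ψ := by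
  rw [hasTotalMomentum_zero_iff]
  intro s X
  obtain ⟨Θs, hΘs⟩ := Θ.exists_translate (-s)
  have hE : periodicEnergy v Θs = periodicGroundStateEnergy v N L :=
    (periodicEnergy_translate v Θ (-s) hΘs).trans hΘ
  have h := norm_eq_norm_of_minimisers hv hfin hC2 hN hL Θs Θ hE hΘ hΘfin X
  have hX : (X - fun _ => -s) = fun i => X i + s := by
    funext i
    simp only [Pi.sub_apply, sub_neg_eq_add]
  rw [hΘs] at h
  dsimp only at h
  rw [hX] at h
  rw [hreal (fun i => X i + s), hreal X, h]

/-! ### The structure bound for every minimiser -/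

/-- `|p|² > 0` for a non-zero mode in a box `L > 0`. [folklore] -/
theorem psq_pos_of_ne_zero (hL : 0 < L) {k : Fin 3 → ℤ} (hk : k ≠ 0) : 0 < psq L k :=
  Real.sqrt_pos.1 (lt_of_lt_of_le (by positivity) (ecsf9093_two_pi_div_le_sqrt_psq hL hk))

/-- The kill-edge's right-hand side is at most `C N²/2`:
`4 (C N / max(ρa, |p|²)) · (N|p|²/8) = (C N²/2) · |p|²/max(ρa,|p|²) ≤ C N²/2`. [folklore] -/
theorem killEdge_rhs_le {C Nr ρa p : ℝ} (hC : 0 ≤ C) (hp : 0 < p) :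
    4 * (C * Nr / max ρa p) * (Nr * p / 8) ≤ C * Nr ^ 2 / 2 := by
  have hM : p ≤ max ρa p := le_max_right _ _
  have hMpos : 0 < max ρa p := hp.trans_le hM
  have hratio : p / max ρa p ≤ 1 := (div_le_one hMpos).2 hM
  have hrw : 4 * (C * Nr / max ρa p) * (Nr * p / 8) = C * Nr ^ 2 / 2 * (p / max ρa p) := by
    field_simp
    ring
  rw [hrw]
  calc C * Nr ^ 2 / 2 * (p / max ρa p) ≤ C * Nr ^ 2 / 2 * 1 :=
        mul_le_mul_of_nonneg_left hratio (by positivity)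
    _ = C * Nr ^ 2 / 2 := mul_one _

/-- **K1 ⇒ the Onsager–Price structure bound for EVERY torus minimiser, all `N ≥ 1`, density-uniformly.**
Given `StaticResponseBound`, for every smooth-class `v` there are `ρ₀ > 0` and `S ≥ 0` (`S = 2√(C/2)`,
`C` the K1 constant) such that for every `N ≥ 1`, every box `L > 0` with `N/L³ < ρ₀`, every exact
minimiser `Ψ` of finite energy and every mode `k ≠ 0`:
`‖ρ_k†Ψ‖² = ∫_{cell^N} |∑ⱼ e_k(xⱼ)|² |Ψ|² ≤ S·N`. [cite: Stringari1995, §3 (40)] -/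
theorem sq_moment_le_of_staticResponseBound (hK1 : StaticResponseBound) (v : ℝ → ℝ≥0∞)
    (hv : IsRepulsiveFiniteRange v) (hfin : ∀ r, v r ≠ ⊤)
    (hC2 : ContDiff ℝ 2 (fun x : Space => (v ‖x‖).toReal))
    (hedge : ∃ Cₑ : ℝ, ∀ x : Space,
      ‖iteratedFDeriv ℝ 2 (fun x : Space => (v ‖x‖).toReal) x‖ ≤ Cₑ * Real.sqrt ((v ‖x‖).toReal)) :
    ∃ ρ₀ : ℝ, 0 < ρ₀ ∧ ∃ S : ℝ, 0 ≤ S ∧ ∀ N : ℕ, 0 < N → ∀ L : ℝ, 0 < L →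
      (N : ℝ) / L ^ 3 < ρ₀ → ∀ Ψ : PeriodicTrialState N L,
        periodicEnergy v Ψ = periodicGroundStateEnergy v N L → periodicEnergy v Ψ ≠ ⊤ →
        ∀ k : Fin 3 → ℤ, k ≠ 0 →
          ∫⁻ X in cellN N L, (‖∑ j, cellWave L k (X j)‖₊ : ℝ≥0∞) ^ 2 * (‖Ψ.ψ X‖₊ : ℝ≥0∞) ^ 2 ≤
            ENNReal.ofReal (S * N) := by
  obtain ⟨ρ₀, hρ₀, C, hC, hK⟩ := hyperuniformity_of_staticResponseBound hK1 v hv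
  refine ⟨ρ₀, hρ₀, 2 * Real.sqrt (C / 2), by positivity, ?_⟩
  intro N hN L hL hρL Ψ hΨ hΨfin k hk
  have hN1 : 1 ≤ N := hN
  have hNr : (0 : ℝ) < N := by exact_mod_cast hN
  -- the box is the thermodynamic box of its own density `ρ = N/L³`
  obtain ⟨ρ, hρdef⟩ : ∃ ρ : ℝ, ρ = (N : ℝ) / L ^ 3 := ⟨_, rfl⟩
  rw [← hρdef] at hρL
  have hρ : 0 < ρ := by rw [hρdef]; positivity
  have hside : sideLength ρ N = L := by rw [hρdef]; exact ecsf9093_sideLength_eq hN hL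
  -- the positive minimiser, translation invariant
  obtain ⟨m, rfl⟩ : ∃ m, N = m + 1 := ⟨N - 1, (Nat.succ_pred_eq_of_pos hN).symm⟩
  obtain ⟨Θ, hΘE, hΘfin, -, hΘreal, -⟩ :=
    Summit.AtomisticToContinuum.BoseEinsteinCondensation.Theorems.PositiveMinimiser_proof v hv hfin hC2
      hedge m L hL
  have hΘtr : HasTotalMomentum 0 Θ.ψ :=
    hasTotalMomentum_zero_of_real_minimiser hv hfin hC2 hN1 hL Θ hΘE hΘfin hΘreal
  -- K1's hyperuniformity of `Θ`, read in the box `L`: the COS² moment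
  have hKρ := hK ρ hρ hρL (m + 1) hN
  rw [hside] at hKρ
  have hcos2 := hKρ k hk Θ hΘreal hΘtr hΘE hΘfin
  set Icos : ℝ := ∫ X in cellN (m + 1) L,
    (∑ j, Real.cos (2 * Real.pi / L * ∑ i, (k i : ℝ) * X j i)) ^ 2 * ‖Θ.ψ X‖ ^ 2 with hIcos
  set Isin : ℝ := ∫ X in cellN (m + 1) L,
    (∑ j, Real.sin (2 * Real.pi / L * ∑ i, (k i : ℝ) * X j i)) ^ 2 * ‖Θ.ψ X‖ ^ 2 with hIsin
  have hp : 0 < psq L k := psq_pos_of_ne_zero hL hk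
  have hB : Icos ^ 2 ≤ C * ((m + 1 : ℕ) : ℝ) ^ 2 / 2 := hcos2.trans (killEdge_rhs_le hC.le hp)
  have hIcos0 : 0 ≤ Icos := integral_nonneg fun X => by positivity
  have hcos : Icos ≤ ((m + 1 : ℕ) : ℝ) * Real.sqrt (C / 2) := by
    refine (pow_le_pow_iff_left₀ hIcos0 (by positivity) two_ne_zero).1 (hB.trans_eq ?_)
    rw [mul_pow, Real.sq_sqrt (by positivity)]
    ring
  -- the SIN² moment: a quarter-wave translate is a minimiser with the same modulus
  have hsin : Isin ≤ ((m + 1 : ℕ) : ℝ) * Real.sqrt (C / 2) := by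
    obtain ⟨Θ', hΘ'E, hΘ'eq⟩ := thp_exists_translate_sin_sq hL hk Θ
    have hΘ'min : periodicEnergy v Θ' = periodicGroundStateEnergy v (m + 1) L := (hΘ'E v).trans hΘE
    have hmod : ∀ X, ‖Θ'.ψ X‖ = ‖Θ.ψ X‖ :=
      norm_eq_norm_of_minimisers hv hfin hC2 hN1 hL Θ' Θ hΘ'min hΘE hΘfin
    simp only [hmod] at hΘ'eq
    rw [← hIcos, ← hIsin] at hΘ'eq
    rw [← hΘ'eq]
    exact hcos
  -- `|ρ̂_k|² = (∑cos)² + (∑sin)²`, and `|Ψ| = |Θ|`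
  have hmodΨ : ∀ X, ‖Ψ.ψ X‖ = ‖Θ.ψ X‖ :=
    norm_eq_norm_of_minimisers hv hfin hC2 hN1 hL Ψ Θ hΨ hΘE hΘfin
  have hlhs : ∫⁻ X in cellN (m + 1) L,
      (‖∑ j, cellWave L k (X j)‖₊ : ℝ≥0∞) ^ 2 * (‖Ψ.ψ X‖₊ : ℝ≥0∞) ^ 2 =
      ∫⁻ X in cellN (m + 1) L,
        (‖densityWave (m + 1) L k X‖₊ : ℝ≥0∞) ^ 2 * (‖Θ.ψ X‖₊ : ℝ≥0∞) ^ 2 := by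
    refine lintegral_congr fun X => ?_
    rw [← planeWaveSum_eq_densityWave, planeWaveSum, coe_nnnorm_sq_eq_ofReal (Ψ.ψ X),
      coe_nnnorm_sq_eq_ofReal (Θ.ψ X), hmodΨ X]
  rw [hlhs, ecsf9093_lintegral_densityWave_sq_eq k Θ]
  refine ENNReal.ofReal_le_ofReal ?_
  have hΘc := Θ.contDiff.continuous
  have hcont_cos : Continuous fun X : Config (m + 1) =>
      (∑ j, Real.cos (2 * Real.pi / L * ∑ i, (k i : ℝ) * X j i)) ^ 2 * ‖Θ.ψ X‖ ^ 2 := by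
    fun_prop
  have hcont_sin : Continuous fun X : Config (m + 1) =>
      (∑ j, Real.sin (2 * Real.pi / L * ∑ i, (k i : ℝ) * X j i)) ^ 2 * ‖Θ.ψ X‖ ^ 2 := by
    fun_prop
  have hsplit : ∫ X in cellN (m + 1) L, ‖densityWave (m + 1) L k X‖ ^ 2 * ‖Θ.ψ X‖ ^ 2 =
      Icos + Isin :=
    calc ∫ X in cellN (m + 1) L, ‖densityWave (m + 1) L k X‖ ^ 2 * ‖Θ.ψ X‖ ^ 2
        = ∫ X in cellN (m + 1) L,
            ((∑ j, Real.cos (2 * Real.pi / L * ∑ i, (k i : ℝ) * X j i)) ^ 2 * ‖Θ.ψ X‖ ^ 2 +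
              (∑ j, Real.sin (2 * Real.pi / L * ∑ i, (k i : ℝ) * X j i)) ^ 2 * ‖Θ.ψ X‖ ^ 2) := by
          congr 1 with X
          rw [thp_norm_densityWave_sq, add_mul]
      _ = Icos + Isin := integral_add (integrableOn_cellN hcont_cos L) (integrableOn_cellN hcont_sin L)
  rw [hsplit]
  calc Icos + Isin ≤ ((m + 1 : ℕ) : ℝ) * Real.sqrt (C / 2) + ((m + 1 : ℕ) : ℝ) * Real.sqrt (C / 2) :=
        add_le_add hcos hsin
    _ = 2 * Real.sqrt (C / 2) * ((m + 1 : ℕ) : ℝ) := by ring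

end Summit.AtomisticToContinuum.BoseEinsteinCondensation.Theorems.CorrectorClosure.VolumeHomotopySumRuleDomination

end
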